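import Summits.HodgeConjecture.CorCM.IrreducibleOddWeightsCoreTower
import Summits.HodgeConjecture.CorCM.IrreducibleOddWeightsCanonicalPivotTraceCount
import HarnessLib

/-!
# Core tower, II: two ARBITRARY CM fields — the defect `dim Hg(A₀) + dim Hg(A₁) − dim Hg(A₀ × A₁)` computed on the
# Galois closure of the TRACE OF THE TRACE, and the type-free criteria this yields

COR-CM (cell `pub-hodgecm2`, binder seat `b16` gen 67, count-neutral claim CORE TOWER, file A2 — CM fields; theorems
only, no definition, no named fact, no `sorry`).  NEW as stated, hence under `Summits/`.  HONEST FRAMING: exact,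
hypothesis-free formulas and sufficient criteria for `Hg(A₀ × A₁) = Hg(A₀) × Hg(A₁)` (abelian varieties with complex
multiplication by two arbitrary CM fields); no Hodge class is claimed algebraic; `HC_CM` is neither used nor asserted.

SETTING.  CM fields `K_{i₀}, K_{i₁}`, CM types `Φ_κ`, `u_κ = 2·𝟙_{Φ_κ} − 1` on `Hom(K_κ, ℂ)`, `A_κ ⊨ (K_κ; Φ_κ)`; `Aut(ℂ)`
acts on embeddings; `L_κ = normalClosure ℚ K_κ ℂ`.  For an AUXILIARY number field `T` write `L_T = normalClosure ℚ T ℂ`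
(a normal subfield of `ℂ`), `Aut(ℂ/L_T) = {n | n ∘ y = y ∀ y : T → ℂ}` and
`F_κ^T = span{ g ↦ Σ_{t ∈ Aut(ℂ/L_T)·a} u_κ(g ∘ t) : a ∈ Hom(K_κ, ℂ) }` — the matrix coefficients of slot `κ` SUMMED OVER
THE CLASSES OF EMBEDDINGS AGREEING ON THE TRACE `a⁻¹(L_T)` (§1).  Gen 65/66 (C1/C2) proved
`dim Hg(A₀) + dim Hg(A₁) − dim Hg(A₀ × A₁) = dim(F₀^{K₁} ∩ F₁^{K₀})` (traces of `L₁` on `K₀` and of `L₀` on `K₁`).  File A1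
(`IrreducibleOddWeightsCoreTower`) showed abstractly that such pivots are ABSORBING.  Here, for `Aut(ℂ)`:

* §1 `Aut(ℂ/L_T)`-orbits on `Hom(K, ℂ)` are the classes agreeing on the trace `a⁻¹(L_T)`
  (`exists_stabAux_smul_eq_iff_forall_apply_eq`, any number field `T`; C2 had `T = K_{i₁}`); the trace does not depend on
  `a` (`apply_mem_normalClosure_aux_iff`); **MOVERS FROM CONTAINMENT** (`exists_stabAux_smul_eq_of_forall_mem`): if
  `a(K) ∩ L_T ⊆ L_{T'}` for every `a`, then `Aut(ℂ/L_{T'})` moves every embedding inside its `Aut(ℂ/L_T)`-class; a REAL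
  trace makes the classes conjugation-stable; and THE TRACE FIELD ITSELF ABSORBS (`apply_mem_normalClosure_comap_of_mem`):
  `T' = b₀⁻¹(L_T) ≤ K_{i₁}` satisfies the containment for slot `1`.
* §2 **THE TOWER.**  Level one (C1): `MC₀ ∩ MC₁ = F₀^{K₀} ∩ F₁^{K₀}`.  **Level two** (`span_coeff_inf_eq_of_traces_le`): for
  ANY number field `T₁` with `b(K₁) ∩ L₀ ⊆ L_{T₁}` for all `b` — canonically the trace field `T₁ = K₁ ∩ L₀` itself, so that
  `E₁ := L_{T₁}` is the GALOIS CLOSURE OF THE TRACE, a subfield of `L₀ ∩ L₁`, in general strictly smaller —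
  **`MC₀ ∩ MC₁ = F₀^{T₁} ∩ F₁^{T₁}`** and **`dim Hg(A₀) + dim Hg(A₁) − dim Hg(A₀ × A₁) = dim(F₀^{T₁} ∩ F₁^{T₁})`**
  (`cmTypeRank_add_cmTypeRank_eq_cmFamilyRank_add_one_add_finrank_of_traces_le`): the defect of EVERY type pair is decided
  by the classes of embeddings agreeing on the traces of `E₁`.  **Level three** (`…_of_traces_le_of_traces_le`): `T₂` with
  `a(K₀) ∩ E₁ ⊆ L_{T₂}` (canonically `E₂` = Galois closure of `K₀ ∩ E₁`), and so on (the general step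
  `span_coeff_inf_eq_of_absorbed_of_forall_mem{,'}`).
* §3 **TYPE-FREE CRITERIA** (`cmFamilyRank_add_card_eq_pair_of_traces_le_of_forall_conj_apply_eq`, canonical form
  `…_of_forall_conj_apply_eq_traceClosure`, level three `…_of_traces_le_of_traces_le_of_forall_conj_apply_eq`): **if
  `a(K₀) ∩ E₁ ⊂ ℝ` for every embedding `a` (`E₁` the Galois closure of the trace `K₁ ∩ L₀`), then
  `Hg(A₀ × A₁) = Hg(A₀) × Hg(A₁)` for ALL CM types**, the pair is nondegenerate iff both members are, and there are no
  mixed Hodge classes (file A3).  This strictly contains the real-trace criterion (C2/C7: `a(K₀) ∩ L₁ ⊂ ℝ`), the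
  Galois-slot criterion (T4) and the quadratic-meet criterion (O8).  EXAMPLE (new): `F, F′` non-isomorphic non-Galois
  cubic fields with the same quadratic resolvent `ℚ(√D)`, `d > 0`, `K₀ = F(√(−dD))`, `K₁ = F′(√−d)`: the traces
  `K₀ ∩ L₁ = ℚ(√(−dD))` and `K₁ ∩ L₀ = ℚ(√−d)` are both CM and `L₀ ∩ L₁ = ℚ(√D, √−d)` is CM, so no earlier field criterion
  applies; but `E₁ = ℚ(√−d)` meets every `a(K₀)` in `ℚ`, hence additivity for all types.

## References

* [Gordon1999HodgeAVSurvey] B. B. Gordon, *A survey of the Hodge conjecture for abelian varieties*, §3, 7.5–7.7.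
* [Lang2002] S. Lang, *Algebra*, 3rd ed., VI §1 Thm. 1.1, Cor. 1.6, Thm. 1.12 and V §2 Thm. 2.8.
* [MoonenZarhin1999LowDim] B. Moonen, Yu. Zarhin, Math. Ann. 315 (1999), Thm. (0.2), §3 (3.1).
* [Deligne1982HodgeCycles] P. Deligne, *Hodge cycles on abelian varieties*, LNM 900 (1982), I.5 (p. 62).
* [Shimura1998] G. Shimura, *Abelian Varieties with Complex Multiplication and Modular Functions*, §8.3, §18.1.
-/

set_option autoImplicit false

noncomputable section

open scoped BigOperators Classical
open NumberField Module IntermediateField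

namespace Summit.HodgeConjecture.CorCM

open Literature.NumberTheory.ComplexMultiplication Literature.AlgebraicGeometry.Pohlmann1968
open Literature.NumberTheory.NumberFields (mem_closure_fixing_union_of_apply_eq)
open Literature.AlgebraicGeometry.Motives (CMType)

/-! ### §1 An auxiliary number field `T`: `Aut(ℂ/L_T)`, the trace description of its orbits, movers, absorption -/

section Aux

variable {T : Type} [Field T] [NumberField T] {I : Type} {K : I → Type} [∀ i, Field (K i)] [∀ i, NumberField (K i)]

omit [NumberField T] in
/-- **`Aut(ℂ/L_T)` is the stabiliser of all embeddings of `T`**: an automorphism of `ℂ` fixes every `y : T → ℂ` iff it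
fixes `L_T = normalClosure ℚ T ℂ` pointwise. [cite: Lang2002, V §2 Thm. 2.8] -/
theorem forall_smul_eq_iff_forall_mem_normalClosure_aux [NumberField T] (n : ℂ ≃+* ℂ) :
    (∀ y : T →+* ℂ, n • y = y) ↔ ∀ z : ℂ, z ∈ normalClosure ℚ T ℂ → n z = z :=
  forall_smul_eq_iff_forall_mem_normalClosure (K := fun _ : Unit => T) () n

/-- **THE TRACE DESCRIPTION OF THE `Aut(ℂ/L_T)`-ORBITS ON `Hom(K_{i₀}, ℂ)`, `T` ANY number field**: `t'` is an
`Aut(ℂ/L_T)`-translate of `t` **iff `t'` and `t` agree on the trace field `t⁻¹(L_T)`** (`⟸`: an automorphism moving `t`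
to `t'` fixes `t(K_{i₀}) ∩ L_T` pointwise, hence lies in `⟨Aut(ℂ/t(K_{i₀})), Aut(ℂ/L_T)⟩` by the Galois correspondence for
`Aut(ℂ)`, and `Aut(ℂ/L_T)` is normal). [cite: Lang2002, VI §1 Thm. 1.1, Cor. 1.6 and V §2 Thm. 2.8] -/
theorem exists_stabAux_smul_eq_iff_forall_apply_eq {i₀ : I} (t t' : K i₀ →+* ℂ) :
    (∃ n : ℂ ≃+* ℂ, (∀ y : T →+* ℂ, n • y = y) ∧ n • t = t') ↔
      ∀ k : K i₀, t k ∈ normalClosure ℚ T ℂ → t' k = t k := by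
  constructor
  · rintro ⟨n, hn, rfl⟩ k hk
    rw [ringEquiv_smul_apply]
    exact (forall_smul_eq_iff_forall_mem_normalClosure_aux n).1 hn _ hk
  · intro h
    haveI := isPretransitive_ringEquiv_complex (K := K i₀)
    obtain ⟨g, hg⟩ := MulAction.exists_smul_eq (ℂ ≃+* ℂ) t t'
    haveI : FiniteDimensional ℚ (t.toRatAlgHom).fieldRange :=
      LinearEquiv.finiteDimensional (AlgEquiv.ofInjectiveField t.toRatAlgHom).toLinearEquiv
    have hfix : ∀ x : ℂ, x ∈ (t.toRatAlgHom).fieldRange → x ∈ normalClosure ℚ T ℂ → g x = x := by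
      intro x hx hx₁
      obtain ⟨k, rfl⟩ := AlgHom.mem_fieldRange.1 hx
      change g (t k) = t k
      have h1 := h k hx₁
      rw [← hg, ringEquiv_smul_apply] at h1
      exact h1
    have hmem := mem_closure_fixing_union_of_apply_eq hfix
    have key : ∀ s ∈ Subgroup.closure
        ({σ : ℂ ≃+* ℂ | ∀ x : ℂ, x ∈ (t.toRatAlgHom).fieldRange → σ x = x} ∪
          {σ : ℂ ≃+* ℂ | ∀ x : ℂ, x ∈ normalClosure ℚ T ℂ → σ x = x}),
        ∃ n : ℂ ≃+* ℂ, (∀ y : T →+* ℂ, n • y = y) ∧ n • t = s • t := by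
      intro s hs
      induction hs using Subgroup.closure_induction with
      | mem s hs =>
        rcases hs with hs | hs
        · refine ⟨1, fun y => one_smul _ y, ?_⟩
          rw [one_smul]
          refine (RingHom.ext fun k => ?_).symm
          rw [ringEquiv_smul_apply]
          exact hs _ (AlgHom.mem_fieldRange.2 ⟨k, rfl⟩)
        · exact ⟨s, (forall_smul_eq_iff_forall_mem_normalClosure_aux s).2 hs, rfl⟩
      | one => exact ⟨1, fun y => one_smul _ y, rfl⟩
      | mul a b _ _ ha hb =>
        obtain ⟨na, hna, hnat⟩ := ha
        obtain ⟨nb, hnb, hnbt⟩ := hb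
        refine ⟨a * nb * a⁻¹ * na, fun y => ?_, ?_⟩
        · rw [mul_smul, mul_smul, mul_smul, hna, hnb, smul_inv_smul]
        · rw [mul_smul, mul_smul, mul_smul, hnat, inv_smul_smul, hnbt, mul_smul]
      | inv a _ ha =>
        obtain ⟨na, hna, hnat⟩ := ha
        refine ⟨a⁻¹ * na⁻¹ * a, fun y => ?_, ?_⟩
        · rw [mul_smul, mul_smul, inv_smul_eq_iff.2 (hna (a • y)).symm, inv_smul_smul]
        · rw [mul_smul, mul_smul, ← hnat, inv_smul_smul]
    obtain ⟨n, hn, hnt⟩ := key g hmem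
    exact ⟨n, hn, hnt.trans hg⟩

/-- The `Aut(ℂ/L_T)`-orbit sums on `Hom(K_{i₀}, ℂ)` are the sums over the classes of embeddings agreeing on the trace
`a⁻¹(L_T)` (function form, for rewriting under binders). [cite: Lang2002, VI §1 Thm. 1.1 and Cor. 1.6] -/
theorem stabAuxOrbitSum_eq_traceSum {i₀ : I} (Φ₀ : CMType (K i₀)) :
    (fun a : K i₀ →+* ℂ => fun g : ℂ ≃+* ℂ =>
        ∑ t ∈ Finset.univ.filter
          (fun t : K i₀ →+* ℂ => ∃ n : ℂ ≃+* ℂ, (∀ y : T →+* ℂ, n • y = y) ∧ n • a = t), antiVec Φ₀.1 g t) =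
      fun a : K i₀ →+* ℂ => fun g : ℂ ≃+* ℂ =>
        ∑ t ∈ Finset.univ.filter
          (fun t : K i₀ →+* ℂ => ∀ k : K i₀, a k ∈ normalClosure ℚ T ℂ → t k = a k), antiVec Φ₀.1 g t := by
  funext a g
  rw [Finset.filter_congr fun t _ => exists_stabAux_smul_eq_iff_forall_apply_eq (T := T) a t]

/-- **The trace of `L_T` does not depend on the embedding**: `a k ∈ L_T ↔ a' k ∈ L_T` (`a' = σ ∘ a`, `σ(L_T) = L_T`).
[cite: Lang2002, V §2 Thm. 2.8 and VI §1 Thm. 1.1] -/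
theorem apply_mem_normalClosure_aux_iff {i₀ : I} (a a' : K i₀ →+* ℂ) (k : K i₀) :
    a k ∈ normalClosure ℚ T ℂ ↔ a' k ∈ normalClosure ℚ T ℂ := by
  haveI := isPretransitive_ringEquiv_complex (K := K i₀)
  obtain ⟨σ, hσ⟩ := MulAction.exists_smul_eq (ℂ ≃+* ℂ) a a'
  have h1 : a' k = σ (a k) := by rw [← hσ, ringEquiv_smul_apply]
  have h2 : a k = σ.symm (a' k) := by rw [h1, RingEquiv.symm_apply_apply]
  constructor
  · intro h
    rw [h1]
    exact ringEquiv_apply_mem_normalClosure (K := fun _ : Unit => T) () σ h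
  · intro h
    rw [h2]
    exact ringEquiv_apply_mem_normalClosure (K := fun _ : Unit => T) () σ.symm h

/-- **MOVERS FROM CONTAINMENT.**  If `a(K_{i₀}) ∩ L_T ⊆ L_{T'}` for every embedding `a`, then every automorphism
fixing all embeddings of `T'` moves every embedding of `K_{i₀}` inside its `Aut(ℂ/L_T)`-class (it fixes the trace of
`L_T`) — the hypothesis of A1's absorption step. [cite: Lang2002, VI §1 Thm. 1.1 and Cor. 1.6] -/
theorem exists_stabAux_smul_eq_of_forall_mem {T' : Type} [Field T'] [NumberField T'] {i₀ : I}
    (h : ∀ (a : K i₀ →+* ℂ) (k : K i₀), a k ∈ normalClosure ℚ T ℂ → a k ∈ normalClosure ℚ T' ℂ)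
    (m : ℂ ≃+* ℂ) (hm : ∀ y' : T' →+* ℂ, m • y' = y') (a : K i₀ →+* ℂ) :
    ∃ n : ℂ ≃+* ℂ, (∀ y : T →+* ℂ, n • y = y) ∧ n • a = m • a :=
  (exists_stabAux_smul_eq_iff_forall_apply_eq a (m • a)).2 fun k hk => by
    rw [ringEquiv_smul_apply]
    exact (forall_smul_eq_iff_forall_mem_normalClosure_aux m).1 hm _ (h a k hk)

/-- **A real trace makes every class conjugation-stable**: if `a(k)` is real whenever `a(k) ∈ L_T`, then
`ā ∈ Aut(ℂ/L_T)·a`. [cite: Lang2002, VI §1 Cor. 1.6] [cite: Shimura1998, §8.3] -/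
theorem exists_stabAux_smul_eq_conj_of_forall_conj_apply_eq {i₀ : I} (a : K i₀ →+* ℂ)
    (hreal : ∀ k : K i₀, a k ∈ normalClosure ℚ T ℂ → starRingEnd ℂ (a k) = a k) :
    ∃ n : ℂ ≃+* ℂ, (∀ y : T →+* ℂ, n • y = y) ∧ n • a = (starRingAut : ℂ ≃+* ℂ) • a :=
  (exists_stabAux_smul_eq_iff_forall_apply_eq a _).2 fun k hk => by
    rw [ringEquiv_smul_apply, starRingAut_apply, ← starRingEnd_apply, hreal k hk]

/-- **THE TRACE FIELD ITSELF ABSORBS.**  For `b₀ : K_{i₁} → ℂ` let `T' = b₀⁻¹(L_T) ≤ K_{i₁}` be the trace field of `L_T`;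
then `b(K_{i₁}) ∩ L_T ⊆ L_{T'}` for EVERY embedding `b` (the trace does not depend on `b`, and `b|_{T'}` is an embedding of
`T'`), so `T'` — whose Galois closure `L_{T'}` is the compositum of the conjugates of the trace — may serve as the next
level of the tower. [cite: Lang2002, V §2 Thm. 2.8, VI §1 Thm. 1.1 and Thm. 1.12] -/
theorem apply_mem_normalClosure_comap_of_mem {i₁ : I} (b₀ b : K i₁ →+* ℂ) (k : K i₁)
    (hk : b k ∈ normalClosure ℚ T ℂ) :
    b k ∈ normalClosure ℚ ↥((normalClosure ℚ T ℂ).comap b₀.toRatAlgHom) ℂ := by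
  have hk₀ : k ∈ (normalClosure ℚ T ℂ).comap b₀.toRatAlgHom := (apply_mem_normalClosure_aux_iff b b₀ k).1 hk
  exact apply_mem_normalClosure (K := fun _ : Unit => ↥((normalClosure ℚ T ℂ).comap b₀.toRatAlgHom)) ()
    (b.comp (algebraMap ↥((normalClosure ℚ T ℂ).comap b₀.toRatAlgHom) (K i₁))) ⟨k, hk₀⟩

end Aux

/-! ### §2 The tower for two CM fields: absorption step, levels, exact defect, bound -/

section Tower

variable {I : Type} {K : I → Type} [∀ i, Field (K i)] [∀ i, NumberField (K i)]
  {T : Type} [Field T] [NumberField T] {T' : Type} [Field T'] [NumberField T']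

/-- **THE ABSORPTION STEP FOR CM FIELDS (slot `0` driving)**: if `MC₀ ∩ MC₁ = F₀^T ∩ F₁^T` and `a(K_{i₀}) ∩ L_T ⊆ L_{T'}`
for every embedding `a`, then `MC₀ ∩ MC₁ = F₀^{T'} ∩ F₁^{T'}`. [cite: Gordon1999HodgeAVSurvey, §3 Theorem (proof)]
[cite: Lang2002, VI §1 Thm. 1.1 and Cor. 1.6] -/
theorem span_coeff_inf_eq_of_absorbed_of_forall_mem (Φ : ∀ i, CMType (K i)) (i₀ i₁ : I)
    (habs : Submodule.span ℚ (Set.range fun x : K i₀ →+* ℂ => fun g : ℂ ≃+* ℂ => antiVec (Φ i₀).1 g x) ⊓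
        Submodule.span ℚ (Set.range fun x : K i₁ →+* ℂ => fun g : ℂ ≃+* ℂ => antiVec (Φ i₁).1 g x) =
      Submodule.span ℚ (Set.range fun a : K i₀ →+* ℂ => fun g : ℂ ≃+* ℂ =>
          ∑ t ∈ Finset.univ.filter
            (fun t : K i₀ →+* ℂ => ∃ n : ℂ ≃+* ℂ, (∀ y : T →+* ℂ, n • y = y) ∧ n • a = t), antiVec (Φ i₀).1 g t) ⊓
        Submodule.span ℚ (Set.range fun a : K i₁ →+* ℂ => fun g : ℂ ≃+* ℂ =>
          ∑ t ∈ Finset.univ.filter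
            (fun t : K i₁ →+* ℂ => ∃ n : ℂ ≃+* ℂ, (∀ y : T →+* ℂ, n • y = y) ∧ n • a = t), antiVec (Φ i₁).1 g t))
    (h : ∀ (a : K i₀ →+* ℂ) (k : K i₀), a k ∈ normalClosure ℚ T ℂ → a k ∈ normalClosure ℚ T' ℂ) :
    Submodule.span ℚ (Set.range fun x : K i₀ →+* ℂ => fun g : ℂ ≃+* ℂ => antiVec (Φ i₀).1 g x) ⊓
        Submodule.span ℚ (Set.range fun x : K i₁ →+* ℂ => fun g : ℂ ≃+* ℂ => antiVec (Φ i₁).1 g x) =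
      Submodule.span ℚ (Set.range fun a : K i₀ →+* ℂ => fun g : ℂ ≃+* ℂ =>
          ∑ t ∈ Finset.univ.filter
            (fun t : K i₀ →+* ℂ => ∃ n : ℂ ≃+* ℂ, (∀ y : T' →+* ℂ, n • y = y) ∧ n • a = t), antiVec (Φ i₀).1 g t) ⊓
        Submodule.span ℚ (Set.range fun a : K i₁ →+* ℂ => fun g : ℂ ≃+* ℂ =>
          ∑ t ∈ Finset.univ.filter
            (fun t : K i₁ →+* ℂ => ∃ n : ℂ ≃+* ℂ, (∀ y : T' →+* ℂ, n • y = y) ∧ n • a = t), antiVec (Φ i₁).1 g t) :=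
  IrrOdd.span_coeff_inf_eq_of_absorbed_of_movers (G := ℂ ≃+* ℂ) (E := fun i => K i →+* ℂ) (W := T →+* ℂ)
    (W' := T' →+* ℂ) (fun i => (Φ i).1) i₀ i₁ habs.le fun m hm a => exists_stabAux_smul_eq_of_forall_mem h m hm a

/-- **THE ABSORPTION STEP FOR CM FIELDS (slot `1` driving)**: the same with `b(K_{i₁}) ∩ L_T ⊆ L_{T'}` for every `b`.
[cite: Gordon1999HodgeAVSurvey, §3 Theorem (proof)] [cite: Lang2002, VI §1 Thm. 1.1 and Cor. 1.6] -/
theorem span_coeff_inf_eq_of_absorbed_of_forall_mem' (Φ : ∀ i, CMType (K i)) (i₀ i₁ : I)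
    (habs : Submodule.span ℚ (Set.range fun x : K i₀ →+* ℂ => fun g : ℂ ≃+* ℂ => antiVec (Φ i₀).1 g x) ⊓
        Submodule.span ℚ (Set.range fun x : K i₁ →+* ℂ => fun g : ℂ ≃+* ℂ => antiVec (Φ i₁).1 g x) =
      Submodule.span ℚ (Set.range fun a : K i₀ →+* ℂ => fun g : ℂ ≃+* ℂ =>
          ∑ t ∈ Finset.univ.filter
            (fun t : K i₀ →+* ℂ => ∃ n : ℂ ≃+* ℂ, (∀ y : T →+* ℂ, n • y = y) ∧ n • a = t), antiVec (Φ i₀).1 g t) ⊓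
        Submodule.span ℚ (Set.range fun a : K i₁ →+* ℂ => fun g : ℂ ≃+* ℂ =>
          ∑ t ∈ Finset.univ.filter
            (fun t : K i₁ →+* ℂ => ∃ n : ℂ ≃+* ℂ, (∀ y : T →+* ℂ, n • y = y) ∧ n • a = t), antiVec (Φ i₁).1 g t))
    (h : ∀ (b : K i₁ →+* ℂ) (k : K i₁), b k ∈ normalClosure ℚ T ℂ → b k ∈ normalClosure ℚ T' ℂ) :
    Submodule.span ℚ (Set.range fun x : K i₀ →+* ℂ => fun g : ℂ ≃+* ℂ => antiVec (Φ i₀).1 g x) ⊓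
        Submodule.span ℚ (Set.range fun x : K i₁ →+* ℂ => fun g : ℂ ≃+* ℂ => antiVec (Φ i₁).1 g x) =
      Submodule.span ℚ (Set.range fun a : K i₀ →+* ℂ => fun g : ℂ ≃+* ℂ =>
          ∑ t ∈ Finset.univ.filter
            (fun t : K i₀ →+* ℂ => ∃ n : ℂ ≃+* ℂ, (∀ y : T' →+* ℂ, n • y = y) ∧ n • a = t), antiVec (Φ i₀).1 g t) ⊓
        Submodule.span ℚ (Set.range fun a : K i₁ →+* ℂ => fun g : ℂ ≃+* ℂ =>
          ∑ t ∈ Finset.univ.filter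
            (fun t : K i₁ →+* ℂ => ∃ n : ℂ ≃+* ℂ, (∀ y : T' →+* ℂ, n • y = y) ∧ n • a = t), antiVec (Φ i₁).1 g t) :=
  IrrOdd.span_coeff_inf_eq_of_absorbed_of_movers' (G := ℂ ≃+* ℂ) (E := fun i => K i →+* ℂ) (W := T →+* ℂ)
    (W' := T' →+* ℂ) (fun i => (Φ i).1) i₀ i₁ habs.le fun m hm b => exists_stabAux_smul_eq_of_forall_mem h m hm b

/-- **LEVEL TWO OF THE TOWER: `MC₀ ∩ MC₁ = F₀^{T₁} ∩ F₁^{T₁}`** for ANY number field `T₁` such that `b(K_{i₁}) ∩ L₀ ⊆ L_{T₁}`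
for every embedding `b` — canonically the trace field `T₁ = K_{i₁} ∩ L₀` (`apply_mem_normalClosure_comap_of_mem`), for
which `L_{T₁}` is the Galois closure `E₁ ⊆ L₀ ∩ L₁` of the trace: the common matrix coefficients of ANY two types are
common combinations of matrix coefficients summed over the classes agreeing on the traces of `E₁` (level one, C1, is
`T₁ = K_{i₀}`). [cite: Gordon1999HodgeAVSurvey, §3 Theorem (proof)] [cite: Lang2002, VI §1 Thm. 1.1 and Cor. 1.6] -/
theorem span_coeff_inf_eq_of_traces_le (Φ : ∀ i, CMType (K i)) (i₀ i₁ : I)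
    (hT₁ : ∀ (b : K i₁ →+* ℂ) (k : K i₁), b k ∈ normalClosure ℚ (K i₀) ℂ → b k ∈ normalClosure ℚ T ℂ) :
    Submodule.span ℚ (Set.range fun x : K i₀ →+* ℂ => fun g : ℂ ≃+* ℂ => antiVec (Φ i₀).1 g x) ⊓
        Submodule.span ℚ (Set.range fun x : K i₁ →+* ℂ => fun g : ℂ ≃+* ℂ => antiVec (Φ i₁).1 g x) =
      Submodule.span ℚ (Set.range fun a : K i₀ →+* ℂ => fun g : ℂ ≃+* ℂ =>
          ∑ t ∈ Finset.univ.filter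
            (fun t : K i₀ →+* ℂ => ∃ n : ℂ ≃+* ℂ, (∀ y : T →+* ℂ, n • y = y) ∧ n • a = t), antiVec (Φ i₀).1 g t) ⊓
        Submodule.span ℚ (Set.range fun a : K i₁ →+* ℂ => fun g : ℂ ≃+* ℂ =>
          ∑ t ∈ Finset.univ.filter
            (fun t : K i₁ →+* ℂ => ∃ n : ℂ ≃+* ℂ, (∀ y : T →+* ℂ, n • y = y) ∧ n • a = t), antiVec (Φ i₁).1 g t) := by
  have hbase := IrrOdd.span_coeff_inf_eq_span_stabOrbitSum_self_inf (G := ℂ ≃+* ℂ) (E := fun i => K i →+* ℂ)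
    (fun i => (Φ i).1) i₀ i₁
  exact IrrOdd.span_coeff_inf_eq_of_absorbed_of_movers' (G := ℂ ≃+* ℂ) (E := fun i => K i →+* ℂ)
    (W := K i₀ →+* ℂ) (W' := T →+* ℂ) (fun i => (Φ i).1) i₀ i₁ hbase.le
    fun m hm b => exists_stabAux_smul_eq_of_forall_mem (T := K i₀) hT₁ m hm b

/-- **LEVEL THREE: `MC₀ ∩ MC₁ = F₀^{T₂} ∩ F₁^{T₂}`** for `T₁` as in level two and ANY number field `T₂` with
`a(K_{i₀}) ∩ L_{T₁} ⊆ L_{T₂}` for every `a` — canonically `L_{T₂} = E₂`, the Galois closure of the trace `K_{i₀} ∩ E₁`.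
(Continue with `span_coeff_inf_eq_of_absorbed_of_forall_mem'`, `…_of_forall_mem`, alternating.)
[cite: Gordon1999HodgeAVSurvey, §3 Theorem (proof)] [cite: Lang2002, VI §1 Thm. 1.1 and Cor. 1.6] -/
theorem span_coeff_inf_eq_of_traces_le_of_traces_le (Φ : ∀ i, CMType (K i)) (i₀ i₁ : I)
    (hT₁ : ∀ (b : K i₁ →+* ℂ) (k : K i₁), b k ∈ normalClosure ℚ (K i₀) ℂ → b k ∈ normalClosure ℚ T ℂ)
    (hT₂ : ∀ (a : K i₀ →+* ℂ) (k : K i₀), a k ∈ normalClosure ℚ T ℂ → a k ∈ normalClosure ℚ T' ℂ) :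
    Submodule.span ℚ (Set.range fun x : K i₀ →+* ℂ => fun g : ℂ ≃+* ℂ => antiVec (Φ i₀).1 g x) ⊓
        Submodule.span ℚ (Set.range fun x : K i₁ →+* ℂ => fun g : ℂ ≃+* ℂ => antiVec (Φ i₁).1 g x) =
      Submodule.span ℚ (Set.range fun a : K i₀ →+* ℂ => fun g : ℂ ≃+* ℂ =>
          ∑ t ∈ Finset.univ.filter
            (fun t : K i₀ →+* ℂ => ∃ n : ℂ ≃+* ℂ, (∀ y : T' →+* ℂ, n • y = y) ∧ n • a = t), antiVec (Φ i₀).1 g t) ⊓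
        Submodule.span ℚ (Set.range fun a : K i₁ →+* ℂ => fun g : ℂ ≃+* ℂ =>
          ∑ t ∈ Finset.univ.filter
            (fun t : K i₁ →+* ℂ => ∃ n : ℂ ≃+* ℂ, (∀ y : T' →+* ℂ, n • y = y) ∧ n • a = t), antiVec (Φ i₁).1 g t) :=
  span_coeff_inf_eq_of_absorbed_of_forall_mem Φ i₀ i₁ (span_coeff_inf_eq_of_traces_le Φ i₀ i₁ hT₁) hT₂

end Tower

section Rank

variable {I : Type} [Fintype I] {K : I → Type} [∀ i, Field (K i)] [∀ i, NumberField (K i)] [∀ i, IsCMField (K i)]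
  {T : Type} [Field T] [NumberField T] {T' : Type} [Field T'] [NumberField T']

/-- **THE EXACT DEFECT ON LEVEL TWO**: for ANY two CM fields, ANY two types and any `T₁` with `b(K_{i₁}) ∩ L₀ ⊆ L_{T₁}`
(canonically `L_{T₁} = E₁`, the Galois closure of the trace `K_{i₁} ∩ L₀`):
**`dim Hg(A₀) + dim Hg(A₁) − dim Hg(A₀ × A₁) = dim(F₀^{T₁} ∩ F₁^{T₁})`**, `F_κ^{T₁}` spanned by the matrix coefficients of
slot `κ` summed over the classes of embeddings AGREEING ON THE TRACE OF `L_{T₁}` (trace form).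
[cite: Gordon1999HodgeAVSurvey, §3 Theorem and 7.5–7.7] [cite: Deligne1982HodgeCycles, I.5 (p. 62)] -/
theorem cmTypeRank_add_cmTypeRank_eq_cmFamilyRank_add_one_add_finrank_of_traces_le {i₀ i₁ : I} (h01 : i₀ ≠ i₁)
    (hI : ∀ l, l = i₀ ∨ l = i₁) (Φ : ∀ i, CMType (K i))
    (hT₁ : ∀ (b : K i₁ →+* ℂ) (k : K i₁), b k ∈ normalClosure ℚ (K i₀) ℂ → b k ∈ normalClosure ℚ T ℂ) :
    cmTypeRank (Φ i₀) + cmTypeRank (Φ i₁) = CMAlgebra.cmFamilyRank Φ + 1 +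
      Module.finrank ℚ (Submodule.span ℚ (Set.range fun a : K i₀ →+* ℂ => fun g : ℂ ≃+* ℂ =>
            ∑ t ∈ Finset.univ.filter
              (fun t : K i₀ →+* ℂ => ∀ k : K i₀, a k ∈ normalClosure ℚ T ℂ → t k = a k), antiVec (Φ i₀).1 g t) ⊓
          Submodule.span ℚ (Set.range fun a : K i₁ →+* ℂ => fun g : ℂ ≃+* ℂ =>
            ∑ t ∈ Finset.univ.filter
              (fun t : K i₁ →+* ℂ => ∀ k : K i₁, a k ∈ normalClosure ℚ T ℂ → t k = a k), antiVec (Φ i₁).1 g t) :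
          Submodule ℚ ((ℂ ≃+* ℂ) → ℚ)) := by
  haveI : ∀ i, Nonempty (K i →+* ℂ) := fun i => inferInstance
  have h := IrrOdd.typeRank_add_typeRank_eq_add_finrank_of_absorbed (G := ℂ ≃+* ℂ) (E := fun i => K i →+* ℂ)
    (Φ := fun i => (Φ i).1) (fun i => isCMTypeWith_conj (Φ i)) hI h01 (W := T →+* ℂ) (span_coeff_inf_eq_of_traces_le Φ i₀ i₁ hT₁)
  rw [stabAuxOrbitSum_eq_traceSum (T := T) (Φ i₀), stabAuxOrbitSum_eq_traceSum (T := T) (Φ i₁)] at h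
  exact h

/-- **`Hg(A₀ × A₁) = Hg(A₀) × Hg(A₁)` IFF `F₀^{T₁} ∩ F₁^{T₁} = 0`** (level two). [cite: Gordon1999HodgeAVSurvey, §3 Theorem, 7.5–7.7] -/
theorem cmFamilyRank_add_card_eq_pair_iff_inf_eq_bot_of_traces_le {i₀ i₁ : I} (h01 : i₀ ≠ i₁)
    (hI : ∀ l, l = i₀ ∨ l = i₁) (Φ : ∀ i, CMType (K i))
    (hT₁ : ∀ (b : K i₁ →+* ℂ) (k : K i₁), b k ∈ normalClosure ℚ (K i₀) ℂ → b k ∈ normalClosure ℚ T ℂ) :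
    CMAlgebra.cmFamilyRank Φ + Fintype.card I = (∑ i, cmTypeRank (Φ i)) + 1 ↔
      Submodule.span ℚ (Set.range fun a : K i₀ →+* ℂ => fun g : ℂ ≃+* ℂ =>
            ∑ t ∈ Finset.univ.filter
              (fun t : K i₀ →+* ℂ => ∀ k : K i₀, a k ∈ normalClosure ℚ T ℂ → t k = a k), antiVec (Φ i₀).1 g t) ⊓
          Submodule.span ℚ (Set.range fun a : K i₁ →+* ℂ => fun g : ℂ ≃+* ℂ =>
            ∑ t ∈ Finset.univ.filter
              (fun t : K i₁ →+* ℂ => ∀ k : K i₁, a k ∈ normalClosure ℚ T ℂ → t k = a k), antiVec (Φ i₁).1 g t) =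
        (⊥ : Submodule ℚ ((ℂ ≃+* ℂ) → ℚ)) := by
  haveI : ∀ i, Nonempty (K i →+* ℂ) := fun i => inferInstance
  have h := IrrOdd.typeRank_sigmaType_add_card_eq_iff_of_absorbed (G := ℂ ≃+* ℂ) (E := fun i => K i →+* ℂ)
    (Φ := fun i => (Φ i).1) (fun i => isCMTypeWith_conj (Φ i)) hI h01 (W := T →+* ℂ) (span_coeff_inf_eq_of_traces_le Φ i₀ i₁ hT₁)
  rw [stabAuxOrbitSum_eq_traceSum (T := T) (Φ i₀), stabAuxOrbitSum_eq_traceSum (T := T) (Φ i₁)] at h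
  exact h

/-! ### §3 Type-free criteria -/

/-- **THE LEVEL-TWO CRITERION.**  If `b(K_{i₁}) ∩ L₀ ⊆ L_{T₁}` for every `b` and the trace of `L_{T₁}` on `K_{i₀}` is REAL
along every embedding (`a k ∈ L_{T₁} ⟹ a k ∈ ℝ`), then **`Hg(A₀ × A₁) = Hg(A₀) × Hg(A₁)` for EVERY pair of CM types**
(`cmFamilyRank Φ + 2 = cmTypeRank Φ₀ + cmTypeRank Φ₁ + 1`).  With `T₁ = K_{i₁}` this is the real-trace criterion of C2;
with the trace field `T₁ = K_{i₁} ∩ L₀` it asks only that `a(K_{i₀}) ∩ E₁ ⊂ ℝ`, `E₁ ⊆ L₀ ∩ L₁` the Galois closure of the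
trace. [cite: Gordon1999HodgeAVSurvey, §3 Theorem (proof) and 7.5–7.7] [cite: MoonenZarhin1999LowDim, Thm. (0.2)]
[cite: Shimura1998, §8.3] -/
theorem cmFamilyRank_add_card_eq_pair_of_traces_le_of_forall_conj_apply_eq {i₀ i₁ : I} (h01 : i₀ ≠ i₁)
    (hI : ∀ l, l = i₀ ∨ l = i₁) (Φ : ∀ i, CMType (K i))
    (hT₁ : ∀ (b : K i₁ →+* ℂ) (k : K i₁), b k ∈ normalClosure ℚ (K i₀) ℂ → b k ∈ normalClosure ℚ T ℂ)
    (hreal : ∀ (a : K i₀ →+* ℂ) (k : K i₀), a k ∈ normalClosure ℚ T ℂ → starRingEnd ℂ (a k) = a k) :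
    CMAlgebra.cmFamilyRank Φ + Fintype.card I = (∑ i, cmTypeRank (Φ i)) + 1 := by
  haveI : ∀ i, Nonempty (K i →+* ℂ) := fun i => inferInstance
  exact IrrOdd.typeRank_sigmaType_add_card_eq_of_movers_of_rho_stable (G := ℂ ≃+* ℂ) (E := fun i => K i →+* ℂ)
    (Φ := fun i => (Φ i).1) (fun i => isCMTypeWith_conj (Φ i)) hI h01 (W := T →+* ℂ)
    (fun m hm b => exists_stabAux_smul_eq_of_forall_mem (T := K i₀) hT₁ m hm b)
    fun a => exists_stabAux_smul_eq_conj_of_forall_conj_apply_eq a (hreal a)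

/-- **CANONICAL FORM: if `a(K_{i₀}) ∩ E₁ ⊂ ℝ` for every embedding `a`, where `E₁` is the Galois closure in `ℂ` of the
TRACE FIELD `b₀⁻¹(L₀) ≤ K_{i₁}` of `L₀` on `K_{i₁}` (any `b₀`), then `Hg(A₀ × A₁) = Hg(A₀) × Hg(A₁)` for ALL CM types.**
(`E₁ ⊆ L₀ ∩ L₁`; e.g. non-isomorphic cubic fields `F, F′` with a common quadratic resolvent `ℚ(√D)` and
`K₀ = F(√(−dD))`, `K₁ = F′(√−d)`: every earlier trace is CM, `E₁ = ℚ(√−d)` meets each `a(K₀)` in `ℚ`.)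
[cite: Gordon1999HodgeAVSurvey, §3 Theorem (proof) and 7.5–7.7] [cite: MoonenZarhin1999LowDim, Thm. (0.2)]
[cite: Lang2002, VI §1 Thm. 1.12] -/
theorem cmFamilyRank_add_card_eq_pair_of_forall_conj_apply_eq_traceClosure {i₀ i₁ : I} (h01 : i₀ ≠ i₁)
    (hI : ∀ l, l = i₀ ∨ l = i₁) (Φ : ∀ i, CMType (K i)) (b₀ : K i₁ →+* ℂ)
    (hreal : ∀ (a : K i₀ →+* ℂ) (k : K i₀),
      a k ∈ normalClosure ℚ ↥((normalClosure ℚ (K i₀) ℂ).comap b₀.toRatAlgHom) ℂ → starRingEnd ℂ (a k) = a k) :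
    CMAlgebra.cmFamilyRank Φ + Fintype.card I = (∑ i, cmTypeRank (Φ i)) + 1 :=
  cmFamilyRank_add_card_eq_pair_of_traces_le_of_forall_conj_apply_eq h01 hI Φ
    (T := ↥((normalClosure ℚ (K i₀) ℂ).comap b₀.toRatAlgHom))
    (fun b k hk => apply_mem_normalClosure_comap_of_mem (T := K i₀) b₀ b k hk) hreal

/-- **THE LEVEL-THREE CRITERION.**  `T₁` as above, `T₂` with `a(K_{i₀}) ∩ L_{T₁} ⊆ L_{T₂}` for every `a` (canonically
`L_{T₂} = E₂`, the Galois closure of `K_{i₀} ∩ E₁`); if the trace of `L_{T₂}` on `K_{i₁}` is real along every embedding,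
then `Hg(A₀ × A₁) = Hg(A₀) × Hg(A₁)` for every pair of CM types.
[cite: Gordon1999HodgeAVSurvey, §3 Theorem (proof) and 7.5–7.7] [cite: MoonenZarhin1999LowDim, Thm. (0.2)] -/
theorem cmFamilyRank_add_card_eq_pair_of_traces_le_of_traces_le_of_forall_conj_apply_eq {i₀ i₁ : I}
    (h01 : i₀ ≠ i₁) (hI : ∀ l, l = i₀ ∨ l = i₁) (Φ : ∀ i, CMType (K i))
    (hT₁ : ∀ (b : K i₁ →+* ℂ) (k : K i₁), b k ∈ normalClosure ℚ (K i₀) ℂ → b k ∈ normalClosure ℚ T ℂ)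
    (hT₂ : ∀ (a : K i₀ →+* ℂ) (k : K i₀), a k ∈ normalClosure ℚ T ℂ → a k ∈ normalClosure ℚ T' ℂ)
    (hreal : ∀ (b : K i₁ →+* ℂ) (k : K i₁), b k ∈ normalClosure ℚ T' ℂ → starRingEnd ℂ (b k) = b k) :
    CMAlgebra.cmFamilyRank Φ + Fintype.card I = (∑ i, cmTypeRank (Φ i)) + 1 := by
  haveI : ∀ i, Nonempty (K i →+* ℂ) := fun i => inferInstance
  exact IrrOdd.typeRank_sigmaType_add_card_eq_of_movers_of_movers_of_rho_stable (G := ℂ ≃+* ℂ)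
    (E := fun i => K i →+* ℂ) (Φ := fun i => (Φ i).1) (fun i => isCMTypeWith_conj (Φ i)) hI h01
    (W := T →+* ℂ) (W' := T' →+* ℂ)
    (fun m hm b => exists_stabAux_smul_eq_of_forall_mem (T := K i₀) hT₁ m hm b)
    (fun m hm a => exists_stabAux_smul_eq_of_forall_mem hT₂ m hm a)
    fun b => exists_stabAux_smul_eq_conj_of_forall_conj_apply_eq b (hreal b)

/-- … then the pair is nondegenerate iff both members are (level-two criterion). [cite: Gordon1999HodgeAVSurvey, 7.5–7.6.1] -/
theorem isNondegenerateFamily_iff_forall_of_traces_le_of_forall_conj_apply_eq {i₀ i₁ : I} (h01 : i₀ ≠ i₁)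
    (hI : ∀ l, l = i₀ ∨ l = i₁) (Φ : ∀ i, CMType (K i))
    (hT₁ : ∀ (b : K i₁ →+* ℂ) (k : K i₁), b k ∈ normalClosure ℚ (K i₀) ℂ → b k ∈ normalClosure ℚ T ℂ)
    (hreal : ∀ (a : K i₀ →+* ℂ) (k : K i₀), a k ∈ normalClosure ℚ T ℂ → starRingEnd ℂ (a k) = a k) :
    CMAlgebra.IsNondegenerateFamily Φ ↔ ∀ i, IsNondegenerate (Φ i) := by
  haveI : Nonempty I := ⟨i₀⟩
  exact isNondegenerateFamily_iff_forall_of_cmFamilyRank_add_card_eq Φ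
    (cmFamilyRank_add_card_eq_pair_of_traces_le_of_forall_conj_apply_eq h01 hI Φ hT₁ hreal)

end Rank

end Summit.HodgeConjecture.CorCM

end
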